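import Mathlib
import Summits.QuantumFields.YangMills.Theorems.BalabanUVNodesK2NamedJetsRunRemAt

/-!
# IDEA-5 g4 (obstruction-first, round 4) — card `convex-fibre-witten-modulus-kappa3` EDITION 2.3: the MODULUS ROWS re-keyed to the TREE's run letter
# `RunRemAt` (p596574) BY NAME and to skeleton v5's FULL-PREFIX keying (№204); the RUN ANCHOR the modulus carries for free (BN-F (N2) on `ScaleAnchor`)

HONEST FRAMING.  Nothing here proves the Clay Yang–Mills mass gap or any rung of it; R4 closes only the CONDITIONAL finite-𝕋⁴ rung `BalabanLadder.UV`;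
[I] = Bałaban CMP 109 Thm 2 ∕ (0.31) p. 259 (NODE O) is unproved in print; K2⁷ `EndpointGivenBR13SepCoPH` (stmt-QuantumFields-20543) stays OPEN; every
theorem below is elementary real bookkeeping on LETTERS (hypothesis shapes inhabited at no θ here).  What the file shows is WHICH texts the card's engine can
feed, BY NAME, after today's two events: DEF-1's run edition `Thm/BalabanUVNodesK2NamedJetsRunRemAt` (p596574 ✓, commit a76479c972ec) and plan g82's K2⁷ skeleton
v5 16e2ea6200bb4554 (director-ym №204: every stub keyed on the crux's FULL prefix {unity ∧ slots, Admissible, (B), Window13}; letter `RemAt` byte-identical).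

§1 generic (`β : HBeta`, `b : ℕ → ℝ`): the run-keyed MODULUS remainder `RunModRemainder β b ω γ₀` — the tree's `RunConstRemainder β b r γ₀` with the constant `r`
   replaced by `ω(g_k)`, `ω → 0` at `0⁺`, SAME indexing (`k ≤ n`: the β deciding `g_{n+1}` is read too) —; modulus ⟹ constant `r` on a sub-level for EVERY `r > 0`
   (`runConstRemainder_of_runModRemainder`: the seam is the supplier's, no certified constant); the RUN ANCHOR `RunAnchor β b γ₀` (per-scale identification read on
   in-window RUNS of small level, never on the box corner) with `runAnchor_of_runModRemainder` (free under a modulus), `runAnchor_of_scaleAnchor` (box corner ⟹ runs),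
   small bare couplings survive to every fixed depth under per-level survivor bounds (`survive_of_small`), hence in-window runs of every depth EXIST at every small
   level under the modulus letter (`runsExist_of_runModRemainder`), hence the run anchor IDENTIFIES the numbers (`RunAnchor.eq_of_runsExist`,
   `eq_of_runModRemainder`; `RunAnchor.relevel`: the level parameter only caps the witness level).
§2 at NODE 00's Stage-13 record: the card's currency ed. 2.3 `ModRowsAt F κ θ hP c` (modulus rows on runs + (C) on the survivor sets of every sub-level; NO cap, NO
   box anchor); ★ `runRemAt_of_modRowsAt_anchor` (modulus rows + box anchor ⟹ the tree's `RunRemAt F κ θ hP c` BY NAME, cap met with equality on a sub-level);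
   ★ `endpointExistence_of_modRowsAt_drift` (END from modulus rows + bare drift, tree consumer BY NAME, anchor unread); `beta0OfJs_eq_of_modRowsAt` (the modulus rows
   IDENTIFY the named numbers with NO box-corner clause — κ is no free knob).
§3 the stub TEXTS keyed on v5's full prefix, INLINE: 2ᴹ″ `ModRowsSomeJetsK` (∃ κ, modulus rows ∧ box anchor), 2ᴹ‴ `ModRowsSomeJetsK'` (anchor-free), 2ᴮ″ᴷ `RunRemSomeJetsK`
   (DEF-1's 2ᴮ″ + `Window13`), 1ᴮ″ᴷ, the anchor road `D1OfAnchorK` (= the tree's `d1AtShadowingJets_of_drift_of_anchor` hypothesis + full prefix), 1ᴹ‴ `D1AtModRowsK`;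
   bridges 2ᴹ″ ⟹ 2ᴮ″ᴷ, v5's registered 2′ text ⟹ 2ᴮ″ᴷ (box ⟹ runs; NOT conversely — BN-F), and three kernel-checked compositions to the crux decl BY NAME:
   `…_of_runPairK` (1ᴮ″ᴷ + 2ᴮ″ᴷ), `…_of_modRowsK_anchorRoad` (anchor road + 2ᴹ″), `…_of_modPairK` (1ᴹ‴ + 2ᴹ‴).
§4 rev-26 Variant R alignment (plan g82 drawer `D82-REV26/Sketch26.lean`, NOT pressed): with the RUN rows `RowsRun13 F θ h := ∃ κ, RunRemAt F κ θ h θ.cβ` as the displayed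
   hypothesis, K2ᴿ closes from 1ᴮ″ᴷ alone; Sketch26's box `Rows13` ⟹ `RowsRun13`; the modulus rows (+ anchor) ⟹ `RowsRun13`; so under R the card's deliverable is a
   SUPPLIER of K1ᴿ's rows-conjunct AT THE WITNESS (where print's ε's are chosen — the honest home of the engine's smallness needs S1∕S4).
§5 (added 02:4xZ on the event) ALIGNMENT WITH THE REGISTERED SKELETON v6 5a75a2378c79b303 (plan g82 02:32:34Z, LINE 1′ RUN EDITION; stubs `stub_runRemNamedJets13 :
   RunRemAtSomeJets`, `stub_d1AnchoredJets13 : D1AtAnchoredJets`): both registered texts copied VERBATIM under their v6 names, `Iff.rfl` with §3's, the card's 2ᴹ″ DISCHARGES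
   v6's XL stub text (`runRemAtSomeJets_of_modRowsSomeJetsK`), and {1ᴬ, 2ᴹ″} ⟹ the crux decl BY NAME (`EndpointGivenBR13SepCoPH_of_v6_anchoredJets_modRows`).
Sources (context only): [I] = [Balaban1987RG1] Thm 2 p.259, (0.20) p.256, (1.20)–(1.22) + Thm 3 p.264, (2.12)–(2.14) p.268, (5.10) p.293; [II] = [Balaban1988RG2Cluster] (2.41) p.21.
-/

noncomputable section

namespace Summit.QuantumFields.YangMills.Cruxes.EndpointGivenBR13SepCoPH.Idea5Ed23

open Filter Topology
open scoped BigOperators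
open Literature.MathematicalPhysics.QuantumFieldTheory.Balaban1983to89
open Literature.MathematicalPhysics.QuantumFieldTheory.Balaban1983to89.FlowStep
open Literature.MathematicalPhysics.QuantumFieldTheory.Balaban1983to89.DagBinding (EndpointExistence)
open Literature.MathematicalPhysics.QuantumFieldTheory.Balaban1983to89.T4Continuum (T4Family)
open Literature.MathematicalPhysics.QuantumFieldTheory.Balaban1983to89.B12Beta (HistBox)
open Literature.MathematicalPhysics.QuantumFieldTheory.Balaban1983to89.Beta.Drift (OneLoopDrift sum_Ico_ge_of_drift)
open Summit.QuantumFields.YangMills.Theorems.BalabanUVNodesK2JsOfRecord (StepColourData beta0OfJs)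
open Summit.QuantumFields.YangMills.Theorems.BalabanUVNodesK2NamedJetsRemAt (RemAt ScaleAnchor)
open Summit.QuantumFields.YangMills.Theorems.BalabanUVNodesK2NamedJetsRunRemAt
  (Survivors RunConstRemainder SurvCont RunRemAt runRemAt_of_remAt run_of_survivor survUpper_of_runConstRemainder
   endpointExistence_of_drift_runConstRemainder_survCont endpointExistence_of_runRemAt_drift)
open Summit.QuantumFields.YangMills.Theorems.EndpointGivenBR13SepCoPH.Negative.RemNamedJets13FalseOfTwoNormalisations (oneLoopDrift_const_mul)

/-! ## §0 Two elementary helpers -/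

/-- From `ω → 0` as `t → 0⁺`: some `u > 0` with `ω < ε` on `]0, u[`. [folklore] -/
theorem exists_Ioo_of_tendsto {ω : ℝ → ℝ} (hω : Tendsto ω (𝓝[>] 0) (𝓝 0)) {ε : ℝ} (hε : 0 < ε) :
    ∃ u : ℝ, 0 < u ∧ ∀ t : ℝ, 0 < t → t < u → ω t < ε := by
  have hmem : ω ⁻¹' Set.Iio ε ∈ 𝓝[>] (0 : ℝ) := hω (Iio_mem_nhds hε)
  obtain ⟨u, hu, hsub⟩ := mem_nhdsGT_iff_exists_Ioo_subset.mp hmem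
  exact ⟨u, hu, fun t ht htu => hsub ⟨ht, htu⟩⟩

/-- `Step.InInterval` is monotone in the level. [folklore] -/
theorem inInterval_mono {γ γ' : ℝ} {n : ℕ} {gs : ℕ → ℝ} (h : Step.InInterval γ n gs) (hle : γ ≤ γ') :
    Step.InInterval γ' n gs := fun k hk => ⟨(h k hk).1, (h k hk).2.trans hle⟩

/-! ## §1 Generic: the run-keyed MODULUS remainder, the RUN ANCHOR it carries, run existence, identification -/

section Generic

variable {β : HBeta} {b b' : ℕ → ℝ}

/-- HYPOTHESIS SHAPE (never a fact): **THE RUN-KEYED MODULUS REMAINDER** — `|β_{k+1}(g_0,…,g_k) − b_k| ≤ ω(g_k)` at every prefix of every solution of (0.20)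
up to `n` that stays in `]0, γ₀]` (`k ≤ n`): the tree's `RunConstRemainder β b r γ₀` with the constant replaced by a MODULUS of the true coupling `g_k` (the last slot
of a RUN prefix IS the coupling — [I] Thm 3 p. 264 reads β exactly there; (2.13) p. 268 is the printed rate instance `ω(g) = C·g²`-type). [cite: Balaban1987RG1, Thm 3 p.264 and (2.13) p.268] -/
def RunModRemainder (β : HBeta) (b : ℕ → ℝ) (ω : ℝ → ℝ) (γ₀ : ℝ) : Prop :=
  ∀ (n : ℕ) (gs : ℕ → ℝ), RGEqH n β gs → Step.InInterval γ₀ n gs → ∀ k, k ≤ n → |β k (prefixOf gs k) - b k| ≤ ω (gs k)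

/-- The constant letter IS the modulus letter with the constant modulus (so everything typed on `RunModRemainder` specialises to the tree's letter). [folklore] -/
theorem runModRemainder_const_iff {r γ₀ : ℝ} : RunModRemainder β b (fun _ => r) γ₀ ↔ RunConstRemainder β b r γ₀ := Iff.rfl

/-- Level monotonicity. [folklore] -/
theorem RunModRemainder.mono {ω : ℝ → ℝ} {γ₀ γ₁ : ℝ} (h : RunModRemainder β b ω γ₀) (hle : γ₁ ≤ γ₀) : RunModRemainder β b ω γ₁ :=
  fun n gs hrg hI k hk => h n gs hrg (inInterval_mono hI hle) k hk

/-- **MODULUS ⟹ CONSTANT ON A SUB-LEVEL, FOR EVERY `r > 0`** (the seam is the supplier's choice; no certified constant is ever compared with a slope). [folklore] -/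
theorem runConstRemainder_of_runModRemainder {ω : ℝ → ℝ} {γ₀ : ℝ} (hγ₀ : 0 < γ₀) (hω : Tendsto ω (𝓝[>] 0) (𝓝 0))
    (h : RunModRemainder β b ω γ₀) {r : ℝ} (hr : 0 < r) :
    ∃ γ₁ : ℝ, 0 < γ₁ ∧ γ₁ ≤ γ₀ ∧ RunConstRemainder β b r γ₁ := by
  obtain ⟨u, hu, hωu⟩ := exists_Ioo_of_tendsto hω hr
  refine ⟨min γ₀ (u / 2), lt_min hγ₀ (half_pos hu), min_le_left _ _, fun n gs hrg hI k hk => ?_⟩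
  have hgk := hI k hk
  have hωk : ω (gs k) < r :=
    hωu (gs k) hgk.1 (lt_of_le_of_lt hgk.2 (lt_of_le_of_lt (min_le_right _ _) (half_lt_self hu)))
  exact ((h.mono (min_le_left γ₀ (u / 2))) n gs hrg hI k hk).trans hωk.le

/-- HYPOTHESIS SHAPE (never a fact): **THE RUN ANCHOR** — for every scale `k` and `δ > 0` SOME level `γ ≤ γ₀` below which every in-window run prefix of depth `≥ k` has
`|β_{k+1}(g_0,…,g_k) − b_k| ≤ δ`.  The per-scale identification clause READ ON RUNS (all slots true couplings), not on the corner of the box `]0,γ]^{k+1}` with free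
weight ratios (`ScaleAnchor`). [cite: Balaban1987RG1, (2.13) p.268 and Thm 3 p.264] -/
def RunAnchor (β : HBeta) (b : ℕ → ℝ) (γ₀ : ℝ) : Prop :=
  ∀ (k : ℕ) (δ : ℝ), 0 < δ → ∃ γ : ℝ, 0 < γ ∧ γ ≤ γ₀ ∧
    ∀ (n : ℕ) (gs : ℕ → ℝ), RGEqH n β gs → Step.InInterval γ n gs → k ≤ n → |β k (prefixOf gs k) - b k| ≤ δ

/-- The level parameter of the run anchor only caps the witness level: an anchor below `γ₀` is an anchor below ANY positive level (re-levelling). [folklore] -/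
theorem RunAnchor.relevel {γ₀ γ₁ : ℝ} (h : RunAnchor β b γ₀) (hγ₁ : 0 < γ₁) : RunAnchor β b γ₁ := by
  intro k δ hδ
  obtain ⟨γ, hγ, -, hA⟩ := h k δ hδ
  exact ⟨min γ γ₁, lt_min hγ hγ₁, min_le_right _ _, fun n gs hrg hI hk => hA n gs hrg (inInterval_mono hI (min_le_left _ _)) hk⟩

/-- **A MODULUS CARRIES ITS RUN ANCHOR FOR FREE.** [folklore] -/
theorem runAnchor_of_runModRemainder {ω : ℝ → ℝ} {γ₀ : ℝ} (hγ₀ : 0 < γ₀) (hω : Tendsto ω (𝓝[>] 0) (𝓝 0))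
    (h : RunModRemainder β b ω γ₀) : RunAnchor β b γ₀ := by
  intro k δ hδ
  obtain ⟨γ, hγ, hγle, hrc⟩ := runConstRemainder_of_runModRemainder hγ₀ hω h hδ
  exact ⟨γ, hγ, hγle, fun n gs hrg hI hk => hrc n gs hrg hI k hk⟩

/-- **BOX CORNER ⟹ RUNS**: the tree's per-scale `ScaleAnchor β b` gives the run anchor at every positive level (in-window run prefixes lie in the box). [folklore] -/
theorem runAnchor_of_scaleAnchor {γ₀ : ℝ} (hγ₀ : 0 < γ₀) (h : ScaleAnchor β b) : RunAnchor β b γ₀ := by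
  intro k δ hδ
  obtain ⟨γ, hγ, hbox⟩ := h k δ hδ
  refine ⟨min γ γ₀, lt_min hγ hγ₀, min_le_right _ _, fun n gs _ hI hk => hbox _ fun i => ?_⟩
  have hi := hI i ((Nat.lt_succ_iff.mp i.isLt).trans hk)
  exact ⟨hi.1, hi.2.trans (min_le_left _ _)⟩

/-- **SMALL BARE COUPLINGS SURVIVE TO EVERY FIXED DEPTH** under per-level survivor upper bounds `β_k ≤ B_k` (the `hsl` letter of `Gaps/EndSurvivorCensus`): for
`1/x² ≥ 1/γ₀² + Σ_{i<k} |B_i|` the clamped run from `x` keeps `Y_j(x) ≥ 1/x² − Σ_{i<j} |B_i| ≥ 1/γ₀²` for `j ≤ k` (`Y_{j+1} = Y_j − β_j`, `FlowStep.Y_succ'`).  Fixed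
depth, tiny coupling: a UV statement. [cite: Balaban1987RG1, (0.20) p.256] -/
theorem survive_of_small {γ₀ : ℝ} (hγ₀ : 0 < γ₀) (B : ℕ → ℝ)
    (hsl : ∀ (k : ℕ) (x : ℝ), 0 < x → x ≤ γ₀ → (∀ j, j ≤ k → 1 / γ₀ ^ 2 ≤ Y β γ₀ j x) →
      β k (clampPrefix β γ₀ k x) ≤ B k) (k : ℕ) :
    ∃ x₀ : ℝ, 0 < x₀ ∧ x₀ ≤ γ₀ ∧ ∀ x : ℝ, 0 < x → x ≤ x₀ → ∀ j, j ≤ k → 1 / γ₀ ^ 2 ≤ Y β γ₀ j x := by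
  have hT0 : 0 ≤ ∑ i ∈ Finset.range k, |B i| := Finset.sum_nonneg fun i _ => abs_nonneg _
  have hApos : 0 < 1 / γ₀ ^ 2 + ∑ i ∈ Finset.range k, |B i| := by positivity
  refine ⟨min γ₀ (1 / Real.sqrt (1 / γ₀ ^ 2 + ∑ i ∈ Finset.range k, |B i|)), lt_min hγ₀ (by positivity), min_le_left _ _,
    fun x hx0 hxle => ?_⟩
  have hxγ : x ≤ γ₀ := hxle.trans (min_le_left _ _)
  have hxA : 1 / γ₀ ^ 2 + ∑ i ∈ Finset.range k, |B i| ≤ 1 / x ^ 2 := by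
    have hx1 : x ≤ 1 / Real.sqrt (1 / γ₀ ^ 2 + ∑ i ∈ Finset.range k, |B i|) := hxle.trans (min_le_right _ _)
    have hsq : x ^ 2 ≤ (1 / Real.sqrt (1 / γ₀ ^ 2 + ∑ i ∈ Finset.range k, |B i|)) ^ 2 := pow_le_pow_left₀ hx0.le hx1 2
    rw [div_pow, one_pow, Real.sq_sqrt hApos.le] at hsq
    have hx2 : 0 < x ^ 2 := by positivity
    calc 1 / γ₀ ^ 2 + ∑ i ∈ Finset.range k, |B i|
        = 1 / (1 / (1 / γ₀ ^ 2 + ∑ i ∈ Finset.range k, |B i|)) := by rw [one_div_one_div]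
      _ ≤ 1 / x ^ 2 := one_div_le_one_div_of_le hx2 hsq
  have main : ∀ j, j ≤ k → (∀ i, i ≤ j → 1 / γ₀ ^ 2 ≤ Y β γ₀ i x) ∧
      1 / x ^ 2 - ∑ i ∈ Finset.range j, |B i| ≤ Y β γ₀ j x := by
    intro j
    induction j with
    | zero =>
      intro _
      refine ⟨fun i hi => ?_, by simp [Y_zero]⟩
      obtain rfl := Nat.le_zero.mp hi
      rw [Y_zero]
      linarith
    | succ j ih =>
      intro hj
      obtain ⟨hsurv, hlow⟩ := ih (Nat.le_of_succ_le hj)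
      have hβ : β j (clampPrefix β γ₀ j x) ≤ B j := hsl j x hx0 hxγ hsurv
      have hstep : Y β γ₀ (j + 1) x = Y β γ₀ j x - β j (clampPrefix β γ₀ j x) := Y_succ' j x
      have hBj : B j ≤ |B j| := le_abs_self (B j)
      have hlow' : 1 / x ^ 2 - ∑ i ∈ Finset.range (j + 1), |B i| ≤ Y β γ₀ (j + 1) x := by
        rw [Finset.sum_range_succ, hstep]
        linarith
      have hpartial : ∑ i ∈ Finset.range (j + 1), |B i| ≤ ∑ i ∈ Finset.range k, |B i| :=
        Finset.sum_le_sum_of_subset_of_nonneg (Finset.range_mono hj) fun i _ _ => abs_nonneg _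
      have hsurvj1 : 1 / γ₀ ^ 2 ≤ Y β γ₀ (j + 1) x := by linarith
      refine ⟨fun i hi => ?_, hlow'⟩
      rcases Nat.lt_or_eq_of_le hi with hlt | rfl
      · exact hsurv i (Nat.lt_succ_iff.mp hlt)
      · exact hsurvj1
  exact (main k le_rfl).1

/-- **IN-WINDOW RUNS OF EVERY DEPTH EXIST AT EVERY SMALL LEVEL UNDER THE MODULUS LETTER**: the letter gives per-level survivor bounds `b_k + 1` below some `γ₁ ≤ γ₀`
(`survUpper_of_runConstRemainder` BY NAME on the sub-level where `ω ≤ 1`), small couplings survive (`survive_of_small`), survivors are runs (`run_of_survivor` BY NAME). [folklore] -/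
theorem runsExist_of_runModRemainder {ω : ℝ → ℝ} {γ₀ : ℝ} (hγ₀ : 0 < γ₀) (hω : Tendsto ω (𝓝[>] 0) (𝓝 0))
    (h : RunModRemainder β b ω γ₀) :
    ∃ γ₁ : ℝ, 0 < γ₁ ∧ γ₁ ≤ γ₀ ∧ ∀ γ : ℝ, 0 < γ → γ ≤ γ₁ →
      ∀ k : ℕ, ∃ (n : ℕ) (gs : ℕ → ℝ), k ≤ n ∧ RGEqH n β gs ∧ Step.InInterval γ n gs := by
  obtain ⟨γ₁, hγ₁, hγ₁le, hrc⟩ := runConstRemainder_of_runModRemainder hγ₀ hω h one_pos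
  refine ⟨γ₁, hγ₁, hγ₁le, fun γ hγ hγle k => ?_⟩
  have hrcγ : RunConstRemainder β b 1 γ := hrc.mono hγle
  obtain ⟨x₀, hx₀, hx₀γ, hsurv⟩ := survive_of_small (β := β) hγ (fun k => b k + 1)
    (fun k x hx0 hxγ hs => survUpper_of_runConstRemainder hγ hrcγ k x hx0 hxγ hs) k
  obtain ⟨hrg, hI⟩ := run_of_survivor (β := β) hγ (k := k) (x := x₀) ⟨hx₀, hx₀γ, hsurv x₀ hx₀ le_rfl⟩
  exact ⟨k, _, le_rfl, hrg, hI⟩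

/-- **THE RUN ANCHOR IDENTIFIES THE NUMBERS** as soon as in-window runs of every depth exist at every small level. [folklore] -/
theorem RunAnchor.eq_of_runsExist {γ₀ γ₁ : ℝ} (hγ₁ : 0 < γ₁)
    (hex : ∀ γ : ℝ, 0 < γ → γ ≤ γ₁ → ∀ k : ℕ, ∃ (n : ℕ) (gs : ℕ → ℝ), k ≤ n ∧ RGEqH n β gs ∧ Step.InInterval γ n gs)
    (h : RunAnchor β b γ₀) (h' : RunAnchor β b' γ₀) : b = b' := by
  funext k
  by_contra hne
  have hpos : 0 < |b k - b' k| := abs_pos.mpr (sub_ne_zero.mpr hne)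
  have hδ : 0 < |b k - b' k| / 3 := by positivity
  obtain ⟨γ, hγ, -, hA⟩ := h k _ hδ
  obtain ⟨γ', hγ', -, hA'⟩ := h' k _ hδ
  obtain ⟨n, gs, hkn, hrg, hI⟩ := hex (min γ₁ (min γ γ')) (lt_min hγ₁ (lt_min hγ hγ')) (min_le_left _ _) k
  have h1 := hA n gs hrg (inInterval_mono hI ((min_le_right _ _).trans (min_le_left _ _))) hkn
  have h2 := hA' n gs hrg (inInterval_mono hI ((min_le_right _ _).trans (min_le_right _ _))) hkn
  have h3 : |b k - b' k| ≤ |β k (prefixOf gs k) - b' k| + |β k (prefixOf gs k) - b k| := by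
    calc |b k - b' k| = |(β k (prefixOf gs k) - b' k) - (β k (prefixOf gs k) - b k)| := by congr 1; ring
      _ ≤ |β k (prefixOf gs k) - b' k| + |β k (prefixOf gs k) - b k| := abs_sub _ _
  linarith

/-- … so under the modulus letter two reference sequences of the SAME β agree — identification WITHOUT any box-corner clause. [folklore] -/
theorem eq_of_runModRemainder {ω ω' : ℝ → ℝ} {γ₀ : ℝ} (hγ₀ : 0 < γ₀) (hω : Tendsto ω (𝓝[>] 0) (𝓝 0)) (hω' : Tendsto ω' (𝓝[>] 0) (𝓝 0))
    (h : RunModRemainder β b ω γ₀) (h' : RunModRemainder β b' ω' γ₀) : b = b' := by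
  obtain ⟨γ₁, hγ₁, -, hex⟩ := runsExist_of_runModRemainder hγ₀ hω h
  exact RunAnchor.eq_of_runsExist hγ₁ hex (runAnchor_of_runModRemainder hγ₀ hω h) (runAnchor_of_runModRemainder hγ₀ hω' h')

/-- **RUN-WISE (PS) AND END FROM DRIFT + MODULUS + RUN-WISE (C)** (generic, forward-generated constructions): choose the sub-level where `ω ≤` the rescaled slope `s`
(the cap `r ≤ s` of the tree's consumer met with `r := s`), then `endpointExistence_of_drift_runConstRemainder_survCont` BY NAME.  Needs `0 < s` (the modulus can only
undercut a POSITIVE slope) and (C) on the survivor sets of the sub-level. [cite: Balaban1987RG1, Thm 2 p.259 (first sentence) and (5.10) p.293] -/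
theorem endpointExistence_of_drift_runModRemainder_survCont {C : B12.Construction} (hgen : DagBinding.ForwardGenerated C β) {γ₀ s A : ℝ} {ω : ℝ → ℝ}
    (hγ₀ : 0 < γ₀) (hs : 0 < s) (hdrift : OneLoopDrift s A b) (hω : Tendsto ω (𝓝[>] 0) (𝓝 0)) (hmod : RunModRemainder β b ω γ₀)
    (hsc : ∀ γ₁ : ℝ, 0 < γ₁ → γ₁ ≤ γ₀ → SurvCont β γ₁) : EndpointExistence C := by
  obtain ⟨γ₁, hγ₁, hγ₁le, hrc⟩ := runConstRemainder_of_runModRemainder hγ₀ hω hmod hs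
  exact endpointExistence_of_drift_runConstRemainder_survCont hgen hγ₁ hdrift hrc le_rfl (hsc γ₁ hγ₁ hγ₁le)

end Generic

/-! ## §2 The card's currency EDITION 2.3 at NODE 00's Stage-13 record, and its bridges to the tree's run letter BY NAME -/

section Letter

/-- **THE MODULUS ROWS `ModRowsAt F κ θ hP c` (card ed. 2.3)**: at some level `γ₀ ≤ θ.γ`, ONE modulus `ω → 0⁺` with the run-keyed modulus remainder of the record's β
relative to the `c`-scaled named numbers of the colour datum `κ`, and (C) on the survivor sets of EVERY sub-level.  NO cap (a modulus undercuts every positive slope), NO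
box-corner anchor (the run anchor is implied, §1).  A predicate, never a fact; `hP` enters only through the datum's `βfun`. [cite: Balaban1987RG1, Thm 3 p.264 and (2.13) p.268] -/
def ModRowsAt (F : T4Family) (κ : StepColourData) (θ : Node00.Stage13HParams F 2) (hP : θ.Provisos₁₃SepCoPH F 2) (c : ℝ) : Prop :=
  ∃ (γ₀ : ℝ) (ω : ℝ → ℝ), 0 < γ₀ ∧ γ₀ ≤ θ.γ ∧ Tendsto ω (𝓝[>] 0) (𝓝 0) ∧
    RunModRemainder (Node00.datumOfRecord₁₃SepCoPH F 2 θ hP).βfun (fun k => c * beta0OfJs F κ k) ω γ₀ ∧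
    (∀ γ₁ : ℝ, 0 < γ₁ → γ₁ ≤ γ₀ → SurvCont (Node00.datumOfRecord₁₃SepCoPH F 2 θ hP).βfun γ₁)

variable (F : T4Family) (κ κ' : StepColourData) (θ : Node00.Stage13HParams F 2) (hP : θ.Provisos₁₃SepCoPH F 2)

/-- `0 < θ.cβ` at an admissible Stage-13 tuple (Stage-9 chart clause). [folklore] -/
theorem cβ_pos_of_admissible {F : T4Family} {θ : Node00.Stage13HParams F 2} (hθ : θ.Admissible F 2) : 0 < θ.cβ :=
  hθ.toStage9.chart.1

/-- `0 < stepBal 2 F.L` (the family's block has `1 < L`). [folklore] -/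
theorem stepBal_two_pos : 0 < B12Normalization.stepBal 2 (F.L : ℝ) :=
  B12Normalization.stepBal_pos (by norm_num) (by exact_mod_cast F.hL.2)

variable {F κ κ' θ hP}

/-- **★ MODULUS ROWS + BOX ANCHOR ⟹ THE TREE's RUN LETTER `RunRemAt F κ θ hP c` BY NAME** (`0 < c`): on the sub-level where `ω ≤ c · stepBal 2 F.L` the modulus rows ARE the
run-wise constant remainder with the cap met (equality), (C) is supplied there, the anchor is passed through.  So the card's supplier feeds DEF-1's 2ᴮ″ currency. [folklore] -/
theorem runRemAt_of_modRowsAt_anchor {c : ℝ} (hc : 0 < c) (h : ModRowsAt F κ θ hP c)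
    (hA : ScaleAnchor (Node00.datumOfRecord₁₃SepCoPH F 2 θ hP).βfun (fun k => c * beta0OfJs F κ k)) : RunRemAt F κ θ hP c := by
  obtain ⟨γ₀, ω, hγ₀, hγθ, hω, hmod, hsc⟩ := h
  have hs : 0 < c * B12Normalization.stepBal 2 (F.L : ℝ) := mul_pos hc (stepBal_two_pos F)
  obtain ⟨γ₁, hγ₁, hγ₁le, hrc⟩ := runConstRemainder_of_runModRemainder hγ₀ hω hmod hs
  exact ⟨γ₁, _, hγ₁, hγ₁le.trans hγθ, le_rfl, hrc, hA, hsc γ₁ hγ₁ hγ₁le⟩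

/-- The converse direction FAILS BY SHAPE (recorded so that no seat reads the bridge backwards): a constant remainder is the constant-modulus instance, which does not
tend to `0` unless `r = 0` — the run letter does NOT give modulus rows; the two currencies meet only in what END consumes. [folklore] -/
theorem runModRemainder_of_runRemAt {c : ℝ} (h : RunRemAt F κ θ hP c) :
    ∃ γ₀ s : ℝ, 0 < γ₀ ∧ γ₀ ≤ θ.γ ∧ s ≤ c * B12Normalization.stepBal 2 F.L ∧
      RunModRemainder (Node00.datumOfRecord₁₃SepCoPH F 2 θ hP).βfun (fun k => c * beta0OfJs F κ k) (fun _ => s) γ₀ := by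
  obtain ⟨γ₀, s, hγ₀, hγθ, hcap, hrem, -, -⟩ := h
  exact ⟨γ₀, s, hγ₀, hγθ, hcap, runModRemainder_const_iff.mpr hrem⟩

/-- **★ END AT ONE RECORD FROM THE MODULUS ROWS AT SCALE `c > 0` AND THE BARE DRIFT** (slope `stepBal 2 F.L`, rescaled by `c` via `oneLoopDrift_const_mul` BY NAME); the
anchor is UNREAD; the tree's run-wise consumer BY NAME.  CONDITIONAL; K2⁷ NOT closed. [cite: Balaban1987RG1, Thm 2 p.259 (first sentence), (5.10) p.293 and (2.12)–(2.14) p.268] -/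
theorem endpointExistence_of_modRowsAt_drift {c : ℝ} (hc : 0 < c) (h : ModRowsAt F κ θ hP c) {A : ℝ}
    (hdrift : OneLoopDrift (B12Normalization.stepBal 2 F.L) A (beta0OfJs F κ)) :
    EndpointExistence (Node00.datumOfRecord₁₃SepCoPH F 2 θ hP).C.toB12 := by
  obtain ⟨γ₀, ω, hγ₀, -, hω, hmod, hsc⟩ := h
  exact endpointExistence_of_drift_runModRemainder_survCont (Node00.datumOfRecord₁₃SepCoPH F 2 θ hP).fwd hγ₀
    (mul_pos hc (stepBal_two_pos F)) (oneLoopDrift_const_mul hdrift c) hω hmod hsc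

/-- **THE MODULUS ROWS IDENTIFY THE NAMED NUMBERS — NO BOX-CORNER CLAUSE** (`c ≠ 0`): two colour data whose `c`-scaled numbers both carry modulus rows for the SAME record
have the same one-loop numbers (run anchor for free + runs exist + identification, §1).  κ is no free knob under ed. 2.3 either. [folklore] -/
theorem beta0OfJs_eq_of_modRowsAt {c : ℝ} (hc : c ≠ 0) (h : ModRowsAt F κ θ hP c) (h' : ModRowsAt F κ' θ hP c) :
    beta0OfJs F κ = beta0OfJs F κ' := by
  obtain ⟨γ₀, ω, hγ₀, -, hω, hmod, -⟩ := h
  obtain ⟨γ₀', ω', hγ₀', -, hω', hmod', -⟩ := h'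
  have hm : 0 < min γ₀ γ₀' := lt_min hγ₀ hγ₀'
  have hfun := eq_of_runModRemainder hm hω hω' (hmod.mono (min_le_left _ _)) (hmod'.mono (min_le_right _ _))
  funext k
  exact mul_left_cancel₀ hc (congrFun hfun k)

/-- … at the stub texts' scale `c := θ.cβ` for an ADMISSIBLE tuple. [folklore] -/
theorem beta0OfJs_eq_of_modRowsAt_adm (hθ : θ.Admissible F 2) (h : ModRowsAt F κ θ hP θ.cβ) (h' : ModRowsAt F κ' θ hP θ.cβ) :
    beta0OfJs F κ = beta0OfJs F κ' :=
  beta0OfJs_eq_of_modRowsAt (ne_of_gt (cβ_pos_of_admissible hθ)) h h'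

/-- The modulus rows give the RUN ANCHOR of the scaled numbers at the package's level (what a (D1) prover keyed on ed. 2.3 may use as identification). [folklore] -/
theorem runAnchor_of_modRowsAt {c : ℝ} (h : ModRowsAt F κ θ hP c) :
    ∃ γ₀ : ℝ, 0 < γ₀ ∧ γ₀ ≤ θ.γ ∧ RunAnchor (Node00.datumOfRecord₁₃SepCoPH F 2 θ hP).βfun (fun k => c * beta0OfJs F κ k) γ₀ := by
  obtain ⟨γ₀, ω, hγ₀, hγθ, hω, hmod, -⟩ := h
  exact ⟨γ₀, hγ₀, hγθ, runAnchor_of_runModRemainder hγ₀ hω hmod⟩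

end Letter

/-! ## §3 The stub TEXTS keyed on skeleton v5's FULL prefix (№204), INLINE, their bridges, and three compositions to the crux decl BY NAME -/

section StubsK

/-- K2⁷'s window hypothesis (skeleton v5's local `Window13`, VERBATIM). [folklore] -/
def Window13 (F : T4Family) (θ : Node00.Stage13HParams F 2) (hP : θ.Provisos₁₃SepCoPH F 2) : Prop :=
  ∃ γ₁ : ℝ, 0 < γ₁ ∧ ∀ γ : ℝ, 0 < γ → γ ≤ γ₁ → ∃ P : B12.RunParams, 1 ≤ P.K ∧ ((Node00.datumOfRecord₁₃SepCoPH F 2 θ hP).C P).flow.InInterval γ P.K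

/-- 2ᴹ″ (ed. 2.3, full prefix): SOME colour datum carries the modulus rows AND the box anchor at the record's own scale `θ.cβ`, GIVEN unity ∧ slots, admissibility, (B), window. [folklore] -/
def ModRowsSomeJetsK : Prop :=
  ∀ (F : T4Family) (θ : Node00.Stage13HParams F 2) (hP : θ.Provisos₁₃SepCoPH F 2), (θ.ZhUnity F 2 ∧ θ.SlotsNondegenerate₁₃ F 2) → θ.Admissible F 2 →
    B16.EndStatementBPrinted (Node00.datumOfRecord₁₃SepCoPH F 2 θ hP).C → Window13 F θ hP →
    ∃ κ : StepColourData, ModRowsAt F κ θ hP θ.cβ ∧ ScaleAnchor (Node00.datumOfRecord₁₃SepCoPH F 2 θ hP).βfun (fun k => θ.cβ * beta0OfJs F κ k)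

/-- 2ᴹ‴ (ed. 2.3, full prefix, ANCHOR-FREE): SOME colour datum carries the modulus rows (identification by the run anchor, `beta0OfJs_eq_of_modRowsAt_adm`). [folklore] -/
def ModRowsSomeJetsK' : Prop :=
  ∀ (F : T4Family) (θ : Node00.Stage13HParams F 2) (hP : θ.Provisos₁₃SepCoPH F 2), (θ.ZhUnity F 2 ∧ θ.SlotsNondegenerate₁₃ F 2) → θ.Admissible F 2 →
    B16.EndStatementBPrinted (Node00.datumOfRecord₁₃SepCoPH F 2 θ hP).C → Window13 F θ hP →
    ∃ κ : StepColourData, ModRowsAt F κ θ hP θ.cβ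

/-- 2ᴮ″ᴷ: DEF-1's 2ᴮ″ text (p596574 §3) keyed on v5's full prefix (the extra `Window13` input). [folklore] -/
def RunRemSomeJetsK : Prop :=
  ∀ (F : T4Family) (θ : Node00.Stage13HParams F 2) (hP : θ.Provisos₁₃SepCoPH F 2), (θ.ZhUnity F 2 ∧ θ.SlotsNondegenerate₁₃ F 2) → θ.Admissible F 2 →
    B16.EndStatementBPrinted (Node00.datumOfRecord₁₃SepCoPH F 2 θ hP).C → Window13 F θ hP →
    ∃ κ : StepColourData, RunRemAt F κ θ hP θ.cβ

/-- v5's REGISTERED stub 2′ text `RemAtSomeJets` (box letter `RemAt`, full prefix), VERBATIM shape. [folklore] -/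
def RemAtSomeJetsK : Prop :=
  ∀ (F : T4Family) (θ : Node00.Stage13HParams F 2) (hP : θ.Provisos₁₃SepCoPH F 2), (θ.ZhUnity F 2 ∧ θ.SlotsNondegenerate₁₃ F 2) → θ.Admissible F 2 →
    B16.EndStatementBPrinted (Node00.datumOfRecord₁₃SepCoPH F 2 θ hP).C → Window13 F θ hP →
    ∃ κ : StepColourData, RemAt F κ θ hP θ.cβ

/-- 1ᴮ″ᴷ: DEF-1's 1ᴮ″ text keyed on v5's full prefix. [folklore] -/
def D1AtRunShadowingJetsK : Prop :=
  ∀ (F : T4Family) (κ : StepColourData) (θ : Node00.Stage13HParams F 2) (hP : θ.Provisos₁₃SepCoPH F 2), (θ.ZhUnity F 2 ∧ θ.SlotsNondegenerate₁₃ F 2) → θ.Admissible F 2 →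
    B16.EndStatementBPrinted (Node00.datumOfRecord₁₃SepCoPH F 2 θ hP).C → Window13 F θ hP →
    RunRemAt F κ θ hP θ.cβ → ∃ A : ℝ, OneLoopDrift (B12Normalization.stepBal 2 F.L) A (beta0OfJs F κ)

/-- The ANCHOR ROAD for (D1), full prefix (hypothesis shape of the tree's `d1AtShadowingJets_of_drift_of_anchor` ∕ `d1AtRunShadowingJets_of_drift_of_anchor`). [folklore] -/
def D1OfAnchorK : Prop :=
  ∀ (F : T4Family) (κ : StepColourData) (θ : Node00.Stage13HParams F 2) (hP : θ.Provisos₁₃SepCoPH F 2), (θ.ZhUnity F 2 ∧ θ.SlotsNondegenerate₁₃ F 2) → θ.Admissible F 2 →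
    B16.EndStatementBPrinted (Node00.datumOfRecord₁₃SepCoPH F 2 θ hP).C → Window13 F θ hP →
    ScaleAnchor (Node00.datumOfRecord₁₃SepCoPH F 2 θ hP).βfun (fun k => θ.cβ * beta0OfJs F κ k) →
    ∃ A : ℝ, OneLoopDrift (B12Normalization.stepBal 2 F.L) A (beta0OfJs F κ)

/-- 1ᴹ‴: (D1) keyed on the modulus rows themselves (anchor-free; the identification a prover may use is `runAnchor_of_modRowsAt` ∕ `beta0OfJs_eq_of_modRowsAt_adm`). [folklore] -/
def D1AtModRowsK : Prop :=
  ∀ (F : T4Family) (κ : StepColourData) (θ : Node00.Stage13HParams F 2) (hP : θ.Provisos₁₃SepCoPH F 2), (θ.ZhUnity F 2 ∧ θ.SlotsNondegenerate₁₃ F 2) → θ.Admissible F 2 →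
    B16.EndStatementBPrinted (Node00.datumOfRecord₁₃SepCoPH F 2 θ hP).C → Window13 F θ hP →
    ModRowsAt F κ θ hP θ.cβ → ∃ A : ℝ, OneLoopDrift (B12Normalization.stepBal 2 F.L) A (beta0OfJs F κ)

/-- **2ᴹ″ ⟹ 2ᴮ″ᴷ**: the card's supplier text feeds DEF-1's run pair BY NAME. [folklore] -/
theorem runRemSomeJetsK_of_modRowsSomeJetsK (h : ModRowsSomeJetsK) : RunRemSomeJetsK := fun F θ hP hU hθ hB hwin => by
  obtain ⟨κ, hrows, hA⟩ := h F θ hP hU hθ hB hwin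
  exact ⟨κ, runRemAt_of_modRowsAt_anchor (cβ_pos_of_admissible hθ) hrows hA⟩

/-- **v5's REGISTERED 2′ (box) ⟹ 2ᴮ″ᴷ (runs)** (`runRemAt_of_remAt` BY NAME).  NOT conversely, and NOT from 2ᴹ″: neither nodeO supplier currency (idea-4's run-constant,
this card's run-modulus) gives the box letter — by design (barrier note BN-F: the box at a fixed level contains the constant history at every scale). [folklore] -/
theorem runRemSomeJetsK_of_remAtSomeJetsK (h : RemAtSomeJetsK) : RunRemSomeJetsK := fun F θ hP hU hθ hB hwin => by
  obtain ⟨κ, hRem⟩ := h F θ hP hU hθ hB hwin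
  exact ⟨κ, runRemAt_of_remAt F κ θ hP hRem⟩

/-- 2ᴹ″ ⟹ 2ᴹ‴ (drop the anchor). [folklore] -/
theorem modRowsSomeJetsK'_of_modRowsSomeJetsK (h : ModRowsSomeJetsK) : ModRowsSomeJetsK' := fun F θ hP hU hθ hB hwin =>
  (h F θ hP hU hθ hB hwin).imp fun _ hκ => hκ.1

/-- The anchor road gives 1ᴮ″ᴷ (the run letter keeps the box anchor). [folklore] -/
theorem d1AtRunShadowingJetsK_of_anchorRoad (h : D1OfAnchorK) : D1AtRunShadowingJetsK := fun F κ θ hP hU hθ hB hwin hRun => by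
  obtain ⟨-, -, -, -, -, -, hA, -⟩ := hRun
  exact h F κ θ hP hU hθ hB hwin hA

/-- **★★ COMPOSITION A (kernel, no sorry): 1ᴮ″ᴷ + 2ᴮ″ᴷ ⟹ THE CRUX DECL BY NAME** — DEF-1's run pair under v5's full-prefix keying; `endpointExistence_of_runRemAt_drift` BY NAME.
CONDITIONAL on the two displayed hypothesis shapes; K2⁷ NOT closed. [cite: Balaban1987RG1, Thm 2 p.259 (first sentence) and (5.10) p.293] -/
theorem EndpointGivenBR13SepCoPH_of_runPairK (h₁ : D1AtRunShadowingJetsK) (h₂ : RunRemSomeJetsK) :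
    Summit.QuantumFields.YangMills.Theses.BalabanUVNodes.EndpointGivenBR13SepCoPH := by
  intro F θ hP hU hθ hB hwin
  obtain ⟨κ, hRun⟩ := h₂ F θ hP hU hθ hB hwin
  obtain ⟨A, hdrift⟩ := h₁ F κ θ hP hU hθ hB hwin hRun
  exact endpointExistence_of_runRemAt_drift F κ θ hP hRun hdrift

/-- **★★ COMPOSITION B: THE ANCHOR ROAD + 2ᴹ″ ⟹ THE CRUX DECL BY NAME** — the card's supplier under the cell's recommended (D1) keying (CRIT-1 T2), with ZERO new (D1) text. [folklore] -/
theorem EndpointGivenBR13SepCoPH_of_modRowsK_anchorRoad (hD1 : D1OfAnchorK) (h₂ : ModRowsSomeJetsK) :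
    Summit.QuantumFields.YangMills.Theses.BalabanUVNodes.EndpointGivenBR13SepCoPH :=
  EndpointGivenBR13SepCoPH_of_runPairK (d1AtRunShadowingJetsK_of_anchorRoad hD1) (runRemSomeJetsK_of_modRowsSomeJetsK h₂)

/-- **★★ COMPOSITION C: 1ᴹ‴ + 2ᴹ‴ ⟹ THE CRUX DECL BY NAME** — the anchor-free modulus pair (`endpointExistence_of_modRowsAt_drift`). [folklore] -/
theorem EndpointGivenBR13SepCoPH_of_modPairK (h₁ : D1AtModRowsK) (h₂ : ModRowsSomeJetsK') :
    Summit.QuantumFields.YangMills.Theses.BalabanUVNodes.EndpointGivenBR13SepCoPH := by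
  intro F θ hP hU hθ hB hwin
  obtain ⟨κ, hrows⟩ := h₂ F θ hP hU hθ hB hwin
  obtain ⟨A, hdrift⟩ := h₁ F κ θ hP hU hθ hB hwin hrows
  exact endpointExistence_of_modRowsAt_drift (cβ_pos_of_admissible hθ) hrows hdrift

end StubsK

/-! ## §4 Alignment with plan g82's rev-26 drawer, Variant R (rows displayed): the RUN rows as the displayed hypothesis -/

section VariantR

/-- The RUN rows package at a record (the run edition of Sketch26's `Rows13`, over the tree letter BY NAME). [folklore] -/
def RowsRun13 (F : T4Family) (θ : Node00.Stage13HParams F 2) (h : θ.Provisos₁₃SepCoPH F 2) : Prop :=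
  ∃ κ : StepColourData, RunRemAt F κ θ h θ.cβ

/-- Sketch26's box rows ⟹ the run rows (so a K1ᴿ owing the RUN rows owes LESS; K2ᴿ∕K3ᴿ reading them read a WEAKER hypothesis that still suffices, below). [folklore] -/
theorem rowsRun13_of_rows13 {F : T4Family} {θ : Node00.Stage13HParams F 2} {h : θ.Provisos₁₃SepCoPH F 2}
    (hrows : ∃ κ : StepColourData, RemAt F κ θ h θ.cβ) : RowsRun13 F θ h :=
  hrows.imp fun κ hκ => runRemAt_of_remAt F κ θ h hκ

/-- The card's modulus rows (+ box anchor) at an admissible tuple ⟹ the run rows: under Variant R the card is a SUPPLIER of K1ᴿ's rows-conjunct at the witness. [folklore] -/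
theorem rowsRun13_of_modRows {F : T4Family} {θ : Node00.Stage13HParams F 2} {h : θ.Provisos₁₃SepCoPH F 2} (hθ : θ.Admissible F 2)
    (hrows : ∃ κ : StepColourData, ModRowsAt F κ θ h θ.cβ ∧ ScaleAnchor (Node00.datumOfRecord₁₃SepCoPH F 2 θ h).βfun (fun k => θ.cβ * beta0OfJs F κ k)) :
    RowsRun13 F θ h :=
  hrows.imp fun _ hκ => runRemAt_of_modRowsAt_anchor (cβ_pos_of_admissible hθ) hκ.1 hκ.2

/-- K2ᴿ with the RUN rows displayed (Sketch26's `K2R` with `Rows13 ↦ RowsRun13`). [folklore] -/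
def K2Rrun : Prop :=
  ∀ (F : T4Family) (θ : Node00.Stage13HParams F 2) (h : θ.Provisos₁₃SepCoPH F 2), (θ.ZhUnity F 2 ∧ θ.SlotsNondegenerate₁₃ F 2) → θ.Admissible F 2 →
    B16.EndStatementBPrinted (Node00.datumOfRecord₁₃SepCoPH F 2 θ h).C → RowsRun13 F θ h → Window13 F θ h →
    EndpointExistence (Node00.datumOfRecord₁₃SepCoPH F 2 θ h).C.toB12

/-- **LINE 1′ ON K2ᴿ[run] = 1ᴮ″ᴷ ALONE** (the rows moved to the hypothesis; Sketch26's `k2R_of_stub1prime`, run edition). [folklore] -/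
theorem k2Rrun_of_d1AtRunShadowingJetsK (h₁ : D1AtRunShadowingJetsK) : K2Rrun := fun F θ hP hU hθ hB hrows hwin => by
  obtain ⟨κ, hRun⟩ := hrows
  obtain ⟨A, hdrift⟩ := h₁ F κ θ hP hU hθ hB hwin hRun
  exact endpointExistence_of_runRemAt_drift F κ θ hP hRun hdrift

/-- K2⁷ ⟹ K2ᴿ[run] (discard the rows). [folklore] -/
theorem k2Rrun_of_k2_7 (h : Summit.QuantumFields.YangMills.Theses.BalabanUVNodes.EndpointGivenBR13SepCoPH) : K2Rrun :=
  fun F θ hP hU hθ hB _ hwin => h F θ hP hU hθ hB hwin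

/-- … and K2ᴿ[run] + 2ᴮ″ᴷ ⟹ K2⁷: Variant R moves EXACTLY the ∀θ rows obligation (2ᴮ″ᴷ) out of K2 — nothing else. [folklore] -/
theorem k2_7_of_k2Rrun_runRemSomeJetsK (h : K2Rrun) (h₂ : RunRemSomeJetsK) :
    Summit.QuantumFields.YangMills.Theses.BalabanUVNodes.EndpointGivenBR13SepCoPH :=
  fun F θ hP hU hθ hB hwin => h F θ hP hU hθ hB (h₂ F θ hP hU hθ hB hwin) hwin

end VariantR

/-! ## §5 ALIGNMENT WITH THE REGISTERED K2⁷ SKELETON v6 5a75a2378c79b303 (plan g82, 02:32:34Z; LINE 1′ RUN EDITION — director-ym №24 (a)+(d), CRIT-1 g4 BN-F addendum)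
v6 registers exactly TWO stubs: `stub_runRemNamedJets13 : RunRemAtSomeJets` (2ᴮ″, XL — NODE O's wall) and `stub_d1AnchoredJets13 : D1AtAnchoredJets` (1ᴬ, L), composed by
`EndpointGivenBR13SepCoPH_of_anchoredJetsRun` via the tree's `endpointExistence_of_runRemAt_drift`.  The skeleton lives in the plan's kit (`pub-ymgap-plan/D82-K2V6/`), not in the
tree, so it cannot be imported; its two stub TEXTS are copied here VERBATIM under their v6 NAMES and identified with §3's texts by `Iff.rfl` — so the card's supplier text 2ᴹ″
DISCHARGES v6's XL stub BY TEXT (`runRemAtSomeJets_of_modRowsSomeJetsK`) and v6's own composition shape closes the crux from {1ᴬ, 2ᴹ″} (`EndpointGivenBR13SepCoPH_of_v6_anchoredJets_modRows`). -/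

section V6

/-- v6's REGISTERED stub-2ᴮ″ text `RunRemAtSomeJets` (K2Skeleton13SepCoPHv6.lean :319–322), VERBATIM. [folklore] -/
def RunRemAtSomeJets : Prop :=
  ∀ (F : T4Family) (θ : Node00.Stage13HParams F 2) (hP : θ.Provisos₁₃SepCoPH F 2), (θ.ZhUnity F 2 ∧ θ.SlotsNondegenerate₁₃ F 2) → θ.Admissible F 2 →
    B16.EndStatementBPrinted (Node00.datumOfRecord₁₃SepCoPH F 2 θ hP).C → Window13 F θ hP →
    ∃ κ : StepColourData, RunRemAt F κ θ hP θ.cβ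

/-- v6's REGISTERED stub-1ᴬ text `D1AtAnchoredJets` (K2Skeleton13SepCoPHv6.lean :330–334), VERBATIM. [folklore] -/
def D1AtAnchoredJets : Prop :=
  ∀ (F : T4Family) (κ : StepColourData) (θ : Node00.Stage13HParams F 2) (hP : θ.Provisos₁₃SepCoPH F 2), (θ.ZhUnity F 2 ∧ θ.SlotsNondegenerate₁₃ F 2) → θ.Admissible F 2 →
    B16.EndStatementBPrinted (Node00.datumOfRecord₁₃SepCoPH F 2 θ hP).C → Window13 F θ hP →
    ScaleAnchor (Node00.datumOfRecord₁₃SepCoPH F 2 θ hP).βfun (fun k => θ.cβ * beta0OfJs F κ k) →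
    ∃ A : ℝ, OneLoopDrift (B12Normalization.stepBal 2 F.L) A (beta0OfJs F κ)

/-- §3's 2ᴮ″ᴷ IS v6's registered 2ᴮ″ text (definitional). [folklore] -/
theorem runRemAtSomeJets_iff_runRemSomeJetsK : RunRemAtSomeJets ↔ RunRemSomeJetsK := Iff.rfl

/-- §3's anchor road IS v6's registered 1ᴬ text (definitional). [folklore] -/
theorem d1AtAnchoredJets_iff_d1OfAnchorK : D1AtAnchoredJets ↔ D1OfAnchorK := Iff.rfl

/-- **THE CARD's SUPPLIER TEXT 2ᴹ″ DISCHARGES v6's XL STUB TEXT** (`stub_runRemNamedJets13 : RunRemAtSomeJets`): modulus rows + box anchor at `θ.cβ` ⟹ the run letter, per tuple,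
BY NAME (`runRemAt_of_modRowsAt_anchor`).  A prover dealt v6's stub 2ᴮ″ who obtains the modulus rows from the card's engine closes the stub with this term. [folklore] -/
theorem runRemAtSomeJets_of_modRowsSomeJetsK (h : ModRowsSomeJetsK) : RunRemAtSomeJets :=
  runRemAtSomeJets_iff_runRemSomeJetsK.mpr (runRemSomeJetsK_of_modRowsSomeJetsK h)

/-- **v6's COMPOSITION SHAPE FROM {1ᴬ, 2ᴹ″} TO THE CRUX DECL BY NAME** (kernel, no sorry; CONDITIONAL on the two displayed hypothesis shapes; K2⁷ NOT closed). [folklore] -/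
theorem EndpointGivenBR13SepCoPH_of_v6_anchoredJets_modRows (h₁ : D1AtAnchoredJets) (h₂ : ModRowsSomeJetsK) :
    Summit.QuantumFields.YangMills.Theses.BalabanUVNodes.EndpointGivenBR13SepCoPH :=
  EndpointGivenBR13SepCoPH_of_modRowsK_anchorRoad (d1AtAnchoredJets_iff_d1OfAnchorK.mp h₁) h₂

/-- … and v6's own pair {1ᴬ, 2ᴮ″} under the copied names (= v6's `EndpointGivenBR13SepCoPH_of_anchoredJetsRun`, re-derived through §3's composition A). [folklore] -/
theorem EndpointGivenBR13SepCoPH_of_v6_pair (h₁ : D1AtAnchoredJets) (h₂ : RunRemAtSomeJets) :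
    Summit.QuantumFields.YangMills.Theses.BalabanUVNodes.EndpointGivenBR13SepCoPH :=
  EndpointGivenBR13SepCoPH_of_runPairK (d1AtRunShadowingJetsK_of_anchorRoad (d1AtAnchoredJets_iff_d1OfAnchorK.mp h₁))
    (runRemAtSomeJets_iff_runRemSomeJetsK.mp h₂)

end V6

end Summit.QuantumFields.YangMills.Cruxes.EndpointGivenBR13SepCoPH.Idea5Ed23

end
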